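import Mathlib.Data.Finset.Sort
import Mathlib.Data.Finset.Max
import Mathlib.Data.List.OfFn
import Mathlib.Data.List.GetD
import Mathlib.Data.List.Indexes
import Mathlib.Data.List.Nodup
import Mathlib.Data.List.Sort
import Mathlib.Data.Fintype.Basic
import Mathlib.Data.Fin.Tuple.Basic
import Mathlib.Logic.Function.Basic
import HarnessLib

/-!
# Partial sections on `≤ k` vertices as lists of options: representation and enumeration

Topic `Literature/ModelTheory/FiniteModelTheory`.  Support file for the polynomial-time decision
procedure of cohomological `k`-consistency of graphs (`CohomologicalConsistencyDecision.lean`,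
machine side `CohomologicalConsistencyComplexityProofs.lean`; Ó Conghaile 2022, §4.3.1).  A local
section of the presheaf `𝓗_k(G, H)` for graphs `G` on `Fin n`, `H` on `Fin q` — a map
`↥U → Fin q` on a context `U ⊆ Fin n` — is handled through three presentations:

* `pOf U s : PSec n q = (Fin n → Option (Fin q))` — the PARTIAL COLOURING of the section (`none`
  off `U`); `supp`, `fnOfP` recover the context and the map (`pOf_supp_fnOfP`, `supp_pOf`,
  `exists_eq_pOf`);
* `listOfP g : OSec = List (Option ℕ)` — its LIST (length `n`, entry `i` the colour of vertex `i`),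
  the format of the decision program; `gOf` is a left inverse (`gOf_listOfP`), `IsValid n q t` the
  image; `domL`, `restrL`, `List.set` on lists correspond to `supp`, `restrictP`, `Function.update`
  (`domL_listOfP`, `restrL_listOfP`, `listOfP_update`);
* vertex sets `U ⊆ Fin n` as increasing lists `vlist U : List ℕ`.

and ENUMERATED by the list programs `levels q n j` (all valid lists with exactly `j` coloured
vertices, each once: `mem_levels_iff`, `nodup_levels`), `upTo q n k` (at most `k`),
`incLists n j` (increasing vertex lists of length `j`, `mem_incLists_iff`), `subl k l` (sublists, for
`|l| ≤ k`: `mem_subl_of_sublist`, `sublist_of_mem_subl`) and `colourings q n k Dl` (all colourings of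
the vertex list `Dl`, `mem_colourings_iff`) — every recursion is on the LEVEL `≤ k`, never on the
input, so that for fixed `k` the enumerations are polynomial and realisable on codes without loops
of data-dependent length.

Everything is proved; Mathlib only.
-/

namespace Literature.ModelTheory.FiniteModelTheory

namespace SecLists

open Finset

/-! ### Partial colourings and their lists -/

/-- A PARTIAL COLOURING of `Fin n` by `Fin q` (`none` = uncoloured): the presentation of a local
section `↥U → Fin q` used in the proofs. [folklore] -/
abbrev PSec (n q : ℕ) : Type := Fin n → Option (Fin q)

/-- The list format of the program: entry `i` is the colour of vertex `i`, if any. [folklore] -/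
abbrev OSec : Type := List (Option ℕ)

variable {n q : ℕ}

/-- The support (context) of a partial colouring. [folklore] -/
def supp (g : PSec n q) : Finset (Fin n) := univ.filter fun u => (g u).isSome

/-- Membership in the support. [folklore] -/
@[simp] theorem mem_supp {g : PSec n q} {u : Fin n} : u ∈ supp g ↔ (g u).isSome := by simp [supp]

/-- The section `↥(supp g) → Fin q` of a partial colouring. [folklore] -/
def fnOfP (g : PSec n q) (u : ↥(supp g)) : Fin q := (g u).get (mem_supp.1 u.2)

/-- The partial colouring of a section `s : ↥U → Fin q`. [folklore] -/
def pOf (U : Finset (Fin n)) (s : ↥U → Fin q) : PSec n q := fun u => if h : u ∈ U then some (s ⟨u, h⟩) else none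

/-- Value of `pOf` on the context. [folklore] -/
theorem pOf_apply_of_mem {U : Finset (Fin n)} (s : ↥U → Fin q) {u : Fin n} (h : u ∈ U) : pOf U s u = some (s ⟨u, h⟩) := by
  simp [pOf, h]

/-- Value of `pOf` off the context. [folklore] -/
theorem pOf_apply_of_not_mem {U : Finset (Fin n)} (s : ↥U → Fin q) {u : Fin n} (h : u ∉ U) : pOf U s u = none := by
  simp [pOf, h]

/-- The support of `pOf U s` is `U`. [folklore] -/
@[simp] theorem supp_pOf (U : Finset (Fin n)) (s : ↥U → Fin q) : supp (pOf U s) = U := by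
  ext u; by_cases h : u ∈ U <;> simp [pOf, h]

/-- `pOf U` is injective. [folklore] -/
theorem pOf_injective (U : Finset (Fin n)) : Function.Injective (pOf (q := q) U) := by
  intro s s' h
  funext ⟨u, hu⟩
  have := congrFun h u
  rw [pOf_apply_of_mem s hu, pOf_apply_of_mem s' hu] at this
  exact Option.some.inj this

/-- A partial colouring is `pOf` of its section. [folklore] -/
theorem pOf_supp_fnOfP (g : PSec n q) : pOf (supp g) (fnOfP g) = g := by
  funext u
  by_cases h : (g u).isSome
  · rw [pOf_apply_of_mem _ (mem_supp.2 h)]; simp [fnOfP]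
  · rw [pOf_apply_of_not_mem _ (by simpa using h)]
    rw [Option.not_isSome_iff_eq_none] at h; exact h.symm

/-- A partial colouring with support `U` is `pOf U s` for some section `s`. [folklore] -/
theorem exists_eq_pOf {g : PSec n q} {U : Finset (Fin n)} (h : supp g = U) : ∃ s : ↥U → Fin q, g = pOf U s := by
  subst h; exact ⟨fnOfP g, (pOf_supp_fnOfP g).symm⟩

/-- RESTRICTION of a partial colouring to a vertex set (uncolour the rest). [folklore] -/
def restrictP (g : PSec n q) (D : Finset (Fin n)) : PSec n q := fun u => if u ∈ D then g u else none

/-- Restricting `pOf U s` to `D ⊆ U` is `pOf D` of the restricted section. [folklore] -/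
theorem restrictP_pOf {D U : Finset (Fin n)} (h : D ⊆ U) (s : ↥U → Fin q) :
    restrictP (pOf U s) D = pOf D (fun x => s ⟨x, h x.2⟩) := by
  funext u
  by_cases hu : u ∈ D
  · simp [restrictP, hu, pOf_apply_of_mem _ hu, pOf_apply_of_mem _ (h hu)]
  · simp [restrictP, hu, pOf_apply_of_not_mem _ hu]

/-- The support of a restriction. [folklore] -/
theorem supp_restrictP (g : PSec n q) (D : Finset (Fin n)) : supp (restrictP g D) = D ∩ supp g := by
  ext u; by_cases hu : u ∈ D <;> simp [restrictP, hu]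

/-- The support after colouring a vertex. [folklore] -/
theorem supp_update_some (g : PSec n q) (v : Fin n) (c : Fin q) :
    supp (Function.update g v (some c)) = insert v (supp g) := by
  ext u
  by_cases huv : u = v
  · subst huv; simp
  · simp [huv]

/-- The support after uncolouring a vertex. [folklore] -/
theorem supp_update_none (g : PSec n q) (v : Fin n) :
    supp (Function.update g v none) = (supp g).erase v := by
  ext u
  by_cases huv : u = v
  · subst huv; simp
  · simp [huv]

/-- THE LIST of a partial colouring: entry `i` is the colour of vertex `i`. [folklore] -/
def listOfP (g : PSec n q) : OSec := List.ofFn fun u : Fin n => (g u).map Fin.val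

/-- Length of the list. [folklore] -/
@[simp] theorem length_listOfP (g : PSec n q) : (listOfP g).length = n := by simp [listOfP]

/-- Entries of the list. [folklore] -/
theorem getD_listOfP (g : PSec n q) (i : ℕ) :
    (listOfP g).getD i none = if h : i < n then (g ⟨i, h⟩).map Fin.val else none := by
  unfold listOfP
  split_ifs with h
  · rw [List.getD_eq_getElem _ _ (by simpa using h), List.getElem_ofFn]
  · rw [List.getD_eq_default _ _ (by simpa using Nat.le_of_not_lt h)]

/-- Entries of the list at vertices. [folklore] -/
theorem getD_listOfP_fin (g : PSec n q) (u : Fin n) : (listOfP g).getD u none = (g u).map Fin.val := by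
  rw [getD_listOfP, dif_pos u.isLt]

/-- `listOfP` is injective. [folklore] -/
theorem listOfP_injective : Function.Injective (listOfP (n := n) (q := q)) := by
  intro g g' h
  funext u
  have := congrArg (fun t => t.getD u none) h
  simp only [getD_listOfP_fin] at this
  exact Option.map_injective Fin.val_injective this

/-- Reading a list back as a partial colouring (a left inverse of `listOfP`). [folklore] -/
def gOf (n q : ℕ) (t : OSec) : PSec n q := fun u => (t.getD u none).bind fun c => if h : c < q then some ⟨c, h⟩ else none

/-- `gOf` inverts `listOfP`. [folklore] -/
@[simp] theorem gOf_listOfP (g : PSec n q) : gOf n q (listOfP g) = g := by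
  funext u
  rw [gOf, getD_listOfP_fin]
  cases g u with
  | none => rfl
  | some c => simp [c.isLt]

/-- VALID lists: the lists of partial colourings. [folklore] -/
def IsValid (n q : ℕ) (t : OSec) : Prop := ∃ g : PSec n q, t = listOfP g

/-- A valid list is the list of its reading. [folklore] -/
theorem IsValid.eq_listOfP_gOf {t : OSec} (h : IsValid n q t) : t = listOfP (gOf n q t) := by
  obtain ⟨g, rfl⟩ := h; rw [gOf_listOfP]

/-- Lists of options of equal length with equal entries are equal. [folklore] -/
theorem ext_getD {t t' : OSec} (hl : t.length = t'.length) (h : ∀ i, i < t.length → t.getD i none = t'.getD i none) : t = t' := by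
  refine List.ext_getElem hl fun i h₁ h₂ => ?_
  have := h i h₁
  rwa [List.getD_eq_getElem _ _ h₁, List.getD_eq_getElem _ _ h₂] at this

/-- **Updating a vertex is `List.set` on the list.** [folklore] -/
theorem listOfP_update (g : PSec n q) (v : Fin n) (o : Option (Fin q)) :
    listOfP (Function.update g v o) = (listOfP g).set v (o.map Fin.val) := by
  refine ext_getD (by simp) fun i hi => ?_
  rw [length_listOfP] at hi
  rw [List.getD_eq_getElem?_getD, List.getD_eq_getElem?_getD, List.getElem?_set, length_listOfP]
  have e1 := getD_listOfP (Function.update g v o) i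
  have e2 := getD_listOfP g i
  rw [List.getD_eq_getElem?_getD] at e1 e2
  rw [e1, dif_pos hi]
  by_cases hvi : (v : ℕ) = i
  · have : (⟨i, hi⟩ : Fin n) = v := Fin.ext hvi.symm
    rw [if_pos hvi, this, Function.update_self, if_pos v.isLt]; rfl
  · rw [if_neg hvi, e2, dif_pos hi, Function.update_of_ne (fun h => hvi (congrArg Fin.val h).symm)]

/-- Colouring a vertex is `List.set` with `some`. [folklore] -/
theorem listOfP_update_some (g : PSec n q) (v : Fin n) (c : Fin q) :
    listOfP (Function.update g v (some c)) = (listOfP g).set v (some c.val) := listOfP_update g v (some c)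

/-- Uncolouring a vertex is `List.set` with `none`. [folklore] -/
theorem listOfP_update_none (g : PSec n q) (v : Fin n) :
    listOfP (Function.update g v none) = (listOfP g).set v none := listOfP_update g v none

/-! ### Vertex sets as increasing lists -/

/-- The increasing list of (the values of) a set of vertices. [folklore] -/
def vlist (U : Finset (Fin n)) : List ℕ := (Finset.sort U).map Fin.val

/-- Membership in `vlist`. [folklore] -/
theorem mem_vlist {U : Finset (Fin n)} {i : ℕ} : i ∈ vlist U ↔ ∃ h : i < n, (⟨i, h⟩ : Fin n) ∈ U := by
  simp only [vlist, List.mem_map, Finset.mem_sort]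
  constructor
  · rintro ⟨u, hu, rfl⟩; exact ⟨u.isLt, hu⟩
  · rintro ⟨h, hu⟩; exact ⟨⟨i, h⟩, hu, rfl⟩

/-- Membership of a vertex in `vlist`. [folklore] -/
@[simp] theorem val_mem_vlist {U : Finset (Fin n)} {u : Fin n} : (u : ℕ) ∈ vlist U ↔ u ∈ U := by
  rw [mem_vlist]; exact ⟨fun ⟨_, h⟩ => h, fun h => ⟨u.isLt, h⟩⟩

/-- Members of `vlist` are vertices. [folklore] -/
theorem lt_of_mem_vlist {U : Finset (Fin n)} {i : ℕ} (h : i ∈ vlist U) : i < n := (mem_vlist.1 h).1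

/-- `vlist` has the cardinality as length. [folklore] -/
@[simp] theorem length_vlist (U : Finset (Fin n)) : (vlist U).length = U.card := by
  rw [vlist, List.length_map, Finset.length_sort]

/-- `vlist` is strictly increasing. [folklore] -/
theorem pairwise_vlist (U : Finset (Fin n)) : (vlist U).Pairwise (· < ·) := by
  rw [vlist, List.pairwise_map]
  exact List.sortedLT_iff_pairwise.1 (Finset.sortedLT_sort U)

/-- `vlist` is injective. [folklore] -/
theorem vlist_injective : Function.Injective (vlist (n := n)) := by
  intro U U' h
  ext u
  rw [← val_mem_vlist, ← val_mem_vlist, h]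

/-- Strictly increasing lists with the same members are equal. [folklore] -/
theorem eq_of_pairwise_lt_of_mem_iff {l₁ l₂ : List ℕ} (h₁ : l₁.Pairwise (· < ·)) (h₂ : l₂.Pairwise (· < ·))
    (h : ∀ a, a ∈ l₁ ↔ a ∈ l₂) : l₁ = l₂ := h₁.eq_of_mem_iff h₂ h

/-- `vlist ∅ = []`. [folklore] -/
@[simp] theorem vlist_empty : vlist (∅ : Finset (Fin n)) = [] := by simp [vlist]

/-- `vlist U = []` iff `U = ∅`. [folklore] -/
theorem vlist_eq_nil_iff {U : Finset (Fin n)} : vlist U = [] ↔ U = ∅ := by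
  rw [← List.length_eq_zero_iff, length_vlist, Finset.card_eq_zero]

/-- **Appending a new largest vertex.** [folklore] -/
theorem vlist_insert_of_forall_lt {U : Finset (Fin n)} {v : Fin n} (h : ∀ u ∈ U, u < v) :
    vlist (insert v U) = vlist U ++ [v.val] := by
  have hv : v ∉ U := fun hv => lt_irrefl _ (h v hv)
  refine eq_of_pairwise_lt_of_mem_iff (pairwise_vlist _) ?_ fun a => ?_
  · rw [List.pairwise_append]
    refine ⟨pairwise_vlist U, List.pairwise_singleton _ _, fun a ha b hb => ?_⟩
    rw [List.mem_singleton] at hb; subst hb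
    obtain ⟨ha', haU⟩ := mem_vlist.1 ha
    exact h _ haU
  · rw [List.mem_append, List.mem_singleton, mem_vlist, mem_vlist]
    constructor
    · rintro ⟨ha, hau⟩
      rw [Finset.mem_insert] at hau
      rcases hau with hau | hau
      · right; rw [← hau]
      · exact Or.inl ⟨ha, hau⟩
    · rintro (⟨ha, hau⟩ | rfl)
      · exact ⟨ha, Finset.mem_insert_of_mem hau⟩
      · exact ⟨v.isLt, by simp⟩

/-- **The tail after the smallest vertex.** [folklore] -/
theorem vlist_eq_cons {U : Finset (Fin n)} {v : ℕ} {l : List ℕ} (h : vlist U = v :: l) :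
    ∃ hv : v < n, (⟨v, hv⟩ : Fin n) ∈ U ∧ l = vlist (U.erase ⟨v, hv⟩) := by
  have hvm : v ∈ vlist U := by rw [h]; exact List.mem_cons_self
  obtain ⟨hv, hvU⟩ := mem_vlist.1 hvm
  refine ⟨hv, hvU, ?_⟩
  have hpw := pairwise_vlist U
  rw [h, List.pairwise_cons] at hpw
  refine eq_of_pairwise_lt_of_mem_iff hpw.2 (pairwise_vlist _) fun a => ?_
  rw [mem_vlist]
  constructor
  · intro ha
    have ha' : a ∈ vlist U := by rw [h]; exact List.mem_cons_of_mem v ha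
    obtain ⟨han, haU⟩ := mem_vlist.1 ha'
    refine ⟨han, Finset.mem_erase.2 ⟨fun e => ?_, haU⟩⟩
    have : a = v := congrArg Fin.val e
    exact lt_irrefl _ (this ▸ hpw.1 a ha)
  · rintro ⟨han, haU⟩
    rw [Finset.mem_erase] at haU
    have ha' : a ∈ vlist U := mem_vlist.2 ⟨han, haU.2⟩
    rw [h, List.mem_cons] at ha'
    rcases ha' with rfl | ha'
    · exact absurd rfl haU.1
    · exact ha'

/-- A subset gives a sub-`vlist` (as the filter of the larger one). [folklore] -/
theorem vlist_eq_filter_of_subset {D U : Finset (Fin n)} (h : D ⊆ U) : vlist D = (vlist U).filter fun i => decide (i ∈ vlist D) := by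
  refine eq_of_pairwise_lt_of_mem_iff (pairwise_vlist D) ((pairwise_vlist U).filter _) fun a => ?_
  rw [List.mem_filter, decide_eq_true_iff]
  constructor
  · intro ha
    obtain ⟨han, haD⟩ := mem_vlist.1 ha
    exact ⟨mem_vlist.2 ⟨han, h haD⟩, ha⟩
  · exact fun h => h.2

/-- A subset gives a sublist of `vlist`s. [folklore] -/
theorem vlist_sublist_of_subset {D U : Finset (Fin n)} (h : D ⊆ U) : (vlist D).Sublist (vlist U) := by
  rw [vlist_eq_filter_of_subset h]; exact List.filter_sublist

/-- A sublist of a `vlist` is the `vlist` of a subset. [folklore] -/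
theorem exists_eq_vlist_of_sublist {U : Finset (Fin n)} {l : List ℕ} (h : l.Sublist (vlist U)) :
    ∃ D : Finset (Fin n), D ⊆ U ∧ l = vlist D := by
  classical
  refine ⟨U.filter fun u => (u : ℕ) ∈ l, Finset.filter_subset _ _, ?_⟩
  refine eq_of_pairwise_lt_of_mem_iff ((pairwise_vlist U).sublist h) (pairwise_vlist _) fun a => ?_
  rw [mem_vlist]
  constructor
  · intro ha
    obtain ⟨han, haU⟩ := mem_vlist.1 (h.subset ha)
    exact ⟨han, Finset.mem_filter.2 ⟨haU, ha⟩⟩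
  · rintro ⟨han, haD⟩
    exact (Finset.mem_filter.1 haD).2

/-! ### Domains and restrictions of lists -/

/-- The increasing list of coloured positions. [folklore] -/
def domL (t : OSec) : List ℕ := (List.range t.length).filter fun i => (t.getD i none).isSome

/-- **The domain of the list of `g` is the `vlist` of its support.** [folklore] -/
theorem domL_listOfP (g : PSec n q) : domL (listOfP g) = vlist (supp g) := by
  refine eq_of_pairwise_lt_of_mem_iff (List.pairwise_lt_range.filter _) (pairwise_vlist _) fun a => ?_
  rw [domL, List.mem_filter, List.mem_range, length_listOfP, mem_vlist, getD_listOfP]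
  constructor
  · rintro ⟨ha, hs⟩
    rw [dif_pos ha, Option.isSome_map] at hs
    exact ⟨ha, mem_supp.2 hs⟩
  · rintro ⟨ha, hs⟩
    refine ⟨ha, ?_⟩
    rw [dif_pos ha, Option.isSome_map]
    exact mem_supp.1 hs

/-- Equal domains iff equal supports. [folklore] -/
theorem domL_listOfP_eq_iff (g g' : PSec n q) : domL (listOfP g) = domL (listOfP g') ↔ supp g = supp g' := by
  rw [domL_listOfP, domL_listOfP]; exact ⟨fun h => vlist_injective h, fun h => by rw [h]⟩

/-- The number of coloured positions. [folklore] -/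
theorem length_domL_listOfP (g : PSec n q) : (domL (listOfP g)).length = (supp g).card := by
  rw [domL_listOfP, length_vlist]

/-- RESTRICTION of a list to a list of positions (uncolour the rest). [folklore] -/
def restrL (t : OSec) (Dl : List ℕ) : OSec := t.mapIdx fun i o => if i ∈ Dl then o else none

/-- **Restricting the list of `g` to `vlist D` is the list of the restriction.** [folklore] -/
theorem restrL_listOfP (g : PSec n q) (D : Finset (Fin n)) : restrL (listOfP g) (vlist D) = listOfP (restrictP g D) := by
  unfold restrL
  refine ext_getD (by simp) fun i hi => ?_
  rw [List.length_mapIdx, length_listOfP] at hi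
  rw [List.getD_eq_getElem _ _ (by simpa using hi), List.getElem_mapIdx, getD_listOfP (restrictP g D), dif_pos hi]
  have e := getD_listOfP g i
  rw [dif_pos hi, List.getD_eq_getElem _ _ (by simpa using hi)] at e
  rw [e]
  by_cases h : (⟨i, hi⟩ : Fin n) ∈ D
  · have hm : i ∈ vlist D := mem_vlist.2 ⟨hi, h⟩
    simp [restrictP, hm, h]
  · have hm : i ∉ vlist D := fun hm => h (mem_vlist.1 hm).2
    simp [restrictP, hm, h]

/-! ### Enumeration by levels -/

/-- The everywhere-uncoloured list. [folklore] -/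
def blank (n : ℕ) : OSec := List.replicate n none

/-- `blank n` is the list of the empty partial colouring. [folklore] -/
theorem blank_eq_listOfP (n q : ℕ) : blank n = listOfP (fun _ : Fin n => (none : Option (Fin q))) := by
  refine ext_getD (by simp [blank]) fun i hi => ?_
  rw [blank, List.length_replicate] at hi
  rw [getD_listOfP, dif_pos hi, blank, List.getD_eq_getElem _ _ (by simpa using hi), List.getElem_replicate]
  rfl

/-- Extensions of a list by a colour at a position beyond its domain. [folklore] -/
def exts (q n : ℕ) (t : OSec) : List OSec :=
  ((List.range n).filter fun v => (domL t).all fun i => decide (i < v)).flatMap fun v =>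
    (List.range q).map fun c => t.set v (some c)

/-- LEVEL `j`: the lists of the partial colourings with exactly `j` coloured vertices, each once.
[folklore] -/
def levels (q n : ℕ) : ℕ → List OSec
  | 0 => [blank n]
  | j + 1 => (levels q n j).flatMap (exts q n)

/-- All lists of partial colourings with at most `k` coloured vertices. [folklore] -/
def upTo (q n k : ℕ) : List OSec := (List.range (k + 1)).flatMap (levels q n)

/-- Membership in the extensions of the list of `g`. [folklore] -/
theorem mem_exts_listOfP_iff (g : PSec n q) (t' : OSec) :
    t' ∈ exts q n (listOfP g) ↔ ∃ (v : Fin n) (c : Fin q), (∀ u ∈ supp g, u < v) ∧ t' = listOfP (Function.update g v (some c)) := by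
  simp only [exts, List.mem_flatMap, List.mem_filter, List.mem_range, List.all_eq_true, decide_eq_true_eq,
    List.mem_map, domL_listOfP]
  constructor
  · rintro ⟨v, ⟨hv, hall⟩, c, hc, rfl⟩
    refine ⟨⟨v, hv⟩, ⟨c, hc⟩, fun u hu => hall u (val_mem_vlist.2 hu), ?_⟩
    rw [listOfP_update_some]
  · rintro ⟨v, c, hall, rfl⟩
    refine ⟨v, ⟨v.isLt, fun i hi => ?_⟩, c, c.isLt, ?_⟩
    · obtain ⟨hin, hiU⟩ := mem_vlist.1 hi
      exact hall _ hiU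
    · rw [listOfP_update_some]

/-- **Level `j` lists exactly the partial colourings with `j` coloured vertices.** [folklore] -/
theorem mem_levels_iff (j : ℕ) (t : OSec) : t ∈ levels q n j ↔ ∃ g : PSec n q, t = listOfP g ∧ (supp g).card = j := by
  induction j generalizing t with
  | zero =>
    simp only [levels, List.mem_singleton, Finset.card_eq_zero]
    constructor
    · rintro rfl; exact ⟨fun _ => none, blank_eq_listOfP n q, by ext u; simp⟩
    · rintro ⟨g, rfl, hg⟩
      rw [blank_eq_listOfP n q]
      congr 1; funext u
      by_contra h
      have : u ∈ supp g := mem_supp.2 (Option.ne_none_iff_isSome.1 h)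
      rw [hg] at this; simp at this
  | succ j ih =>
    simp only [levels, List.mem_flatMap]
    constructor
    · rintro ⟨t₀, ht₀, ht⟩
      obtain ⟨g, rfl, hg⟩ := (ih t₀).1 ht₀
      obtain ⟨v, c, hall, rfl⟩ := (mem_exts_listOfP_iff g t).1 ht
      refine ⟨_, rfl, ?_⟩
      have hv : v ∉ supp g := fun hv => lt_irrefl _ (hall v hv)
      rw [supp_update_some, Finset.card_insert_of_notMem hv, hg]
    · rintro ⟨g', rfl, hg'⟩
      have hne : (supp g').Nonempty := Finset.card_pos.1 (by omega)
      set v := (supp g').max' hne with hv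
      have hvmem : v ∈ supp g' := Finset.max'_mem _ _
      obtain ⟨c, hc⟩ := Option.isSome_iff_exists.1 (mem_supp.1 hvmem)
      let g : PSec n q := Function.update g' v none
      have hsupp : supp g = (supp g').erase v := supp_update_none g' v
      have hg : (supp g).card = j := by rw [hsupp, Finset.card_erase_of_mem hvmem, hg']; rfl
      refine ⟨listOfP g, (ih _).2 ⟨g, rfl, hg⟩, (mem_exts_listOfP_iff g _).2 ⟨v, c, fun u hu => ?_, ?_⟩⟩
      · rw [hsupp, Finset.mem_erase] at hu
        exact lt_of_le_of_ne (Finset.le_max' _ _ hu.2) hu.1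
      · congr 1; funext u
        by_cases huv : u = v
        · subst huv; rw [Function.update_self, hc]
        · simp only [g, Function.update_of_ne huv]

/-- In an extension of `listOfP g` by `v`, the new vertex is the largest coloured one. [folklore] -/
theorem eq_max'_of_forall_lt {g : PSec n q} {v : Fin n} {c : Fin q} (hall : ∀ u ∈ supp g, u < v)
    (hne : (supp (Function.update g v (some c))).Nonempty) : (supp (Function.update g v (some c))).max' hne = v := by
  apply le_antisymm
  · apply Finset.max'_le
    intro u hu
    rw [supp_update_some, Finset.mem_insert] at hu
    rcases hu with rfl | hu
    · exact le_rfl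
    · exact (hall u hu).le
  · exact Finset.le_max' _ _ (by rw [supp_update_some]; exact Finset.mem_insert_self _ _)

/-- **Each level lists every partial colouring once.** [folklore] -/
theorem nodup_levels (j : ℕ) : (levels q n j).Nodup := by
  induction j with
  | zero => exact List.nodup_singleton _
  | succ j ih =>
    rw [levels, List.nodup_flatMap]
    constructor
    · -- each `exts t` is duplicate free
      intro t ht
      obtain ⟨g, rfl, -⟩ := (mem_levels_iff j t).1 ht
      rw [exts, List.nodup_flatMap]
      constructor
      · intro v hv
        refine (List.nodup_range.map_on fun c hc c' hc' h => ?_)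
        rw [List.mem_filter, List.mem_range] at hv
        have := congrArg (fun l : OSec => l.getD v none) h
        simp only [List.getD_eq_getElem?_getD, List.getElem?_set, length_listOfP, hv.1, if_true, Option.getD_some] at this
        exact Option.some.inj this
      · refine (List.nodup_range.filter _).pairwise_of_forall_ne fun v hv v' hv' hne => ?_
        simp only [Function.onFun, List.disjoint_left, List.mem_map, List.mem_range]
        rintro _ ⟨c, hc, rfl⟩ ⟨c', hc', h⟩
        rw [List.mem_filter, List.mem_range, List.all_eq_true] at hv hv'
        have hvdom : (listOfP g).getD v none = none := by
          rw [getD_listOfP, dif_pos hv.1, Option.map_eq_none_iff, ← Option.not_isSome_iff_eq_none]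
          intro hs
          have := hv.2 v (by rw [domL_listOfP]; exact val_mem_vlist.2 (mem_supp.2 hs))
          simp at this
        have := congrArg (fun l : OSec => l.getD v none) h
        simp only [List.getD_eq_getElem?_getD, List.getElem?_set, length_listOfP, hv.1, hv'.1, if_true, Ne.symm hne,
          if_false, Option.getD_some] at this
        rw [List.getD_eq_getElem?_getD] at hvdom
        rw [hvdom] at this
        exact absurd this.symm (Option.some_ne_none c)
    · -- extensions of different lists are disjoint
      refine ih.pairwise_of_forall_ne fun t₁ ht₁ t₂ ht₂ hne => ?_
      obtain ⟨g₁, rfl, -⟩ := (mem_levels_iff j t₁).1 ht₁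
      obtain ⟨g₂, rfl, -⟩ := (mem_levels_iff j t₂).1 ht₂
      simp only [Function.onFun, List.disjoint_left]
      intro t' h₁ h₂
      obtain ⟨v₁, c₁, hall₁, rfl⟩ := (mem_exts_listOfP_iff g₁ t').1 h₁
      obtain ⟨v₂, c₂, hall₂, h⟩ := (mem_exts_listOfP_iff g₂ _).1 h₂
      have h' := listOfP_injective h
      have hne' : (supp (Function.update g₁ v₁ (some c₁))).Nonempty :=
        ⟨v₁, by rw [supp_update_some]; exact Finset.mem_insert_self _ _⟩
      have key : ∀ (g : PSec n q) (hne : (supp g).Nonempty), g = Function.update g₂ v₂ (some c₂) → (supp g).max' hne = v₂ := by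
        rintro g hne rfl; exact eq_max'_of_forall_lt hall₂ hne
      have hv : v₁ = v₂ := (eq_max'_of_forall_lt (c := c₁) hall₁ hne').symm.trans (key _ hne' h')
      subst hv
      apply hne
      congr 1
      funext u
      by_cases hu : u = v₁
      · subst hu
        have h1 : g₁ u = none := Option.not_isSome_iff_eq_none.1 fun hs => lt_irrefl _ (hall₁ u (mem_supp.2 hs))
        have h2 : g₂ u = none := Option.not_isSome_iff_eq_none.1 fun hs => lt_irrefl _ (hall₂ u (mem_supp.2 hs))
        rw [h1, h2]
      · have := congrFun h' u
        rwa [Function.update_of_ne hu, Function.update_of_ne hu] at this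

/-- **`upTo q n k` lists exactly the partial colourings with at most `k` coloured vertices.**
[folklore] -/
theorem mem_upTo_iff (k : ℕ) (t : OSec) : t ∈ upTo q n k ↔ ∃ g : PSec n q, t = listOfP g ∧ (supp g).card ≤ k := by
  simp only [upTo, List.mem_flatMap, List.mem_range, mem_levels_iff]
  constructor
  · rintro ⟨j, hj, g, rfl, hg⟩; exact ⟨g, rfl, by omega⟩
  · rintro ⟨g, rfl, hg⟩; exact ⟨_, by omega, g, rfl, rfl⟩

/-- `upTo` is duplicate free. [folklore] -/
theorem nodup_upTo (k : ℕ) : (upTo q n k).Nodup := by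
  rw [upTo, List.nodup_flatMap]
  refine ⟨fun j _ => nodup_levels j, List.nodup_range.pairwise_of_forall_ne fun j _ j' _ hne => ?_⟩
  simp only [Function.onFun, List.disjoint_left]
  intro t h h'
  obtain ⟨g, rfl, hg⟩ := (mem_levels_iff j t).1 h
  obtain ⟨g', hgg', hg'⟩ := (mem_levels_iff j' _).1 h'
  rw [listOfP_injective hgg'] at hg
  exact hne (hg.symm.trans hg')

/-- Members of `upTo` are valid. [folklore] -/
theorem isValid_of_mem_upTo {k : ℕ} {t : OSec} (h : t ∈ upTo q n k) : IsValid n q t := by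
  obtain ⟨g, rfl, -⟩ := (mem_upTo_iff k t).1 h; exact ⟨g, rfl⟩

/-! ### Increasing vertex lists -/

/-- INCREASING LISTS of `j` vertices, each once. [folklore] -/
def incLists (n : ℕ) : ℕ → List (List ℕ)
  | 0 => [[]]
  | j + 1 => (incLists n j).flatMap fun l => ((List.range n).filter fun v => l.all fun i => decide (i < v)).map fun v => l ++ [v]

/-- All increasing vertex lists of length `≤ k`. [folklore] -/
def domsUpTo (n k : ℕ) : List (List ℕ) := (List.range (k + 1)).flatMap (incLists n)

/-- **`incLists n j` lists exactly the `vlist`s of the `j`-element vertex sets.** [folklore] -/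
theorem mem_incLists_iff (j : ℕ) (l : List ℕ) : l ∈ incLists n j ↔ ∃ U : Finset (Fin n), U.card = j ∧ l = vlist U := by
  induction j generalizing l with
  | zero =>
    simp only [incLists, List.mem_singleton, Finset.card_eq_zero]
    constructor
    · rintro rfl; exact ⟨∅, rfl, vlist_empty.symm⟩
    · rintro ⟨U, rfl, rfl⟩; exact vlist_empty
  | succ j ih =>
    simp only [incLists, List.mem_flatMap, List.mem_map, List.mem_filter, List.mem_range, List.all_eq_true, decide_eq_true_eq]
    constructor
    · rintro ⟨l₀, hl₀, v, ⟨hv, hall⟩, rfl⟩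
      obtain ⟨U, hU, rfl⟩ := (ih l₀).1 hl₀
      have hall' : ∀ u ∈ U, u < (⟨v, hv⟩ : Fin n) := fun u hu => hall u (val_mem_vlist.2 hu)
      refine ⟨insert ⟨v, hv⟩ U, ?_, (vlist_insert_of_forall_lt hall').symm⟩
      rw [Finset.card_insert_of_notMem (fun h => lt_irrefl _ (hall' _ h)), hU]
    · rintro ⟨U', hU', rfl⟩
      have hne : U'.Nonempty := Finset.card_pos.1 (by omega)
      set v := U'.max' hne
      have hv : v ∈ U' := Finset.max'_mem _ _
      have hall : ∀ u ∈ U'.erase v, u < v := fun u hu => by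
        rw [Finset.mem_erase] at hu; exact lt_of_le_of_ne (Finset.le_max' _ _ hu.2) hu.1
      refine ⟨vlist (U'.erase v), (ih _).2 ⟨U'.erase v, by rw [Finset.card_erase_of_mem hv, hU']; rfl, rfl⟩, v,
        ⟨v.isLt, fun i hi => ?_⟩, ?_⟩
      · obtain ⟨hin, hiU⟩ := mem_vlist.1 hi; exact hall _ hiU
      · rw [← vlist_insert_of_forall_lt hall, Finset.insert_erase hv]

/-- **`domsUpTo n k` contains the `vlist` of every vertex set of size `≤ k`** (and only such).
[folklore] -/
theorem mem_domsUpTo_iff (k : ℕ) (l : List ℕ) : l ∈ domsUpTo n k ↔ ∃ U : Finset (Fin n), U.card ≤ k ∧ l = vlist U := by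
  simp only [domsUpTo, List.mem_flatMap, List.mem_range, mem_incLists_iff]
  constructor
  · rintro ⟨j, hj, U, hU, rfl⟩; exact ⟨U, by omega, rfl⟩
  · rintro ⟨U, hU, rfl⟩; exact ⟨U.card, by omega, U, rfl, rfl⟩

/-! ### Bounded sublists -/

/-- SUBLISTS of a list, by recursion on a level bound `j` (complete for lists of length `≤ j`).
[folklore] -/
def subl : ℕ → List ℕ → List (List ℕ)
  | 0, _ => [[]]
  | _ + 1, [] => [[]]
  | j + 1, a :: l => (subl j l).map (a :: ·) ++ subl j l

/-- Every member of `subl j l` is a sublist of `l`. [folklore] -/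
theorem sublist_of_mem_subl : ∀ (j : ℕ) (l l' : List ℕ), l' ∈ subl j l → l'.Sublist l
  | 0, l, l', h => by simp [subl] at h; subst h; exact List.nil_sublist l
  | j + 1, [], l', h => by simp [subl] at h; subst h; exact List.Sublist.refl _
  | j + 1, a :: l, l', h => by
    simp only [subl, List.mem_append, List.mem_map] at h
    rcases h with ⟨l'', h, rfl⟩ | h
    · exact (sublist_of_mem_subl j l l'' h).cons_cons a
    · exact (sublist_of_mem_subl j l l' h).cons a

/-- **Every sublist of a list of length `≤ j` is a member of `subl j`.** [folklore] -/
theorem mem_subl_of_sublist : ∀ (j : ℕ) (l l' : List ℕ), l'.Sublist l → l.length ≤ j → l' ∈ subl j l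
  | 0, l, l', h, hl => by
    have : l = [] := List.length_eq_zero_iff.1 (Nat.le_zero.1 hl)
    subst this; rw [List.sublist_nil.1 h]; simp [subl]
  | j + 1, [], l', h, _ => by rw [List.sublist_nil.1 h]; simp [subl]
  | j + 1, a :: l, l', h, hl => by
    simp only [subl, List.mem_append, List.mem_map]
    rw [List.length_cons] at hl
    rcases h with _ | ⟨_, h⟩ | ⟨_, h⟩
    · exact Or.inr (mem_subl_of_sublist j l _ h (by omega))
    · exact Or.inl ⟨_, mem_subl_of_sublist j l _ h (by omega), rfl⟩

/-! ### Colourings of a vertex list -/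

/-- ALL COLOURINGS of the positions in `Dl` (recursion on a level bound `j`, complete for
`|Dl| ≤ j`). [folklore] -/
def colourings (q n : ℕ) : ℕ → List ℕ → List OSec
  | 0, _ => [blank n]
  | _ + 1, [] => [blank n]
  | j + 1, v :: Dl => (colourings q n j Dl).flatMap fun t => (List.range q).map fun c => t.set v (some c)

/-- **`colourings q n j (vlist D)` lists exactly the partial colourings with support `D`**
(`|D| ≤ j`). [folklore] -/
theorem mem_colourings_iff : ∀ (j : ℕ) (D : Finset (Fin n)), D.card ≤ j → ∀ t : OSec,
    t ∈ colourings q n j (vlist D) ↔ ∃ g : PSec n q, t = listOfP g ∧ supp g = D := by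
  have hempty : ∀ t : OSec, t = blank n ↔ ∃ g : PSec n q, t = listOfP g ∧ supp g = ∅ := by
    intro t
    constructor
    · rintro rfl; exact ⟨fun _ => none, blank_eq_listOfP n q, by ext u; simp⟩
    · rintro ⟨g, rfl, hg⟩
      rw [blank_eq_listOfP n q]; congr 1; funext u
      by_contra h
      have : u ∈ supp g := mem_supp.2 (Option.ne_none_iff_isSome.1 h)
      rw [hg] at this; simp at this
  intro j
  induction j with
  | zero =>
    intro D hD t
    have hD0 : D = ∅ := Finset.card_eq_zero.1 (Nat.le_zero.1 hD)
    subst hD0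
    rw [vlist_empty]; simp only [colourings, List.mem_singleton]; exact hempty t
  | succ j ih =>
    intro D hD t
    cases hDl : vlist D with
    | nil =>
      rw [vlist_eq_nil_iff] at hDl; subst hDl
      simp only [colourings, List.mem_singleton]; exact hempty t
    | cons v Dl =>
      obtain ⟨hv, hvD, rfl⟩ := vlist_eq_cons hDl
      have hcard : (D.erase ⟨v, hv⟩).card ≤ j := by rw [Finset.card_erase_of_mem hvD]; omega
      simp only [colourings, List.mem_flatMap, List.mem_map, List.mem_range]
      constructor
      · rintro ⟨t₀, ht₀, c, hc, rfl⟩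
        obtain ⟨g, rfl, hg⟩ := (ih _ hcard t₀).1 ht₀
        refine ⟨Function.update g ⟨v, hv⟩ (some ⟨c, hc⟩), by rw [listOfP_update_some], ?_⟩
        rw [supp_update_some, hg, Finset.insert_erase hvD]
      · rintro ⟨g', rfl, hg'⟩
        have hvmem : (⟨v, hv⟩ : Fin n) ∈ supp g' := hg' ▸ hvD
        obtain ⟨c, hc⟩ := Option.isSome_iff_exists.1 (mem_supp.1 hvmem)
        refine ⟨listOfP (Function.update g' ⟨v, hv⟩ none), (ih _ hcard _).2 ⟨_, rfl, ?_⟩, c, c.isLt, ?_⟩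
        · rw [supp_update_none, hg']
        · have e := listOfP_update_some (Function.update g' ⟨v, hv⟩ none) ⟨v, hv⟩ c
          rw [← e]
          congr 1; funext u
          by_cases hu : u = ⟨v, hv⟩
          · subst hu; rw [Function.update_self, hc]
          · rw [Function.update_of_ne hu, Function.update_of_ne hu]

end SecLists

end Literature.ModelTheory.FiniteModelTheory
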